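import Summits.BirchSwinnertonDyer.Rank1Residual.X11b.KolyvaginSqueezeRecordsKitThree
import HarnessLib

/-!
# BSD rank-≤1 residual cell, rank ONE at `p = 3` with `#Ш_an = 9` (cells (3,'X11b') / (3,'X4') / (3,'X7') /
(3,'X8')): `BSD(E,3)` PER PAIR by the
# Kolyvagin SQUEEZE — Heegner-index certificate `ord₃ [E(K):ℤy_K] = 1` (upper half, two engines) × two-engine EXACT
`3`-descent `dim Sel³(E/ℚ) = 3`
# (lower half, Cassels–Tate) — records 05 of 11 (unit `b2b-bsdres-x11c` GEN 38 «KOLY3-SQUEEZE»,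
prover-b2b-bsdres-x11c-g38-0, 2026-08-28)

HONEST FRAMING (cell `b2b-bsdres-*`, verbatim): prove what is provable now; shrink each hard class to its core with
data; no claim beyond
stated classes; COMBINATION classes deleted from PUBLISHED theorems only, CONSTRUCTION-shaped remainder typed; this
is not "finishing BSD".
X11b (and X11 ∧ r = 1 ∧ p = 3, R6.2), X4, X7, X8 stay CONSTRUCTION-SHAPED as classes; PER PAIR; nothing booked by
this file (referee A
books); NO named fact introduced; NO definition; class labels of other cells' classes (X4: n1011 / additive-p*,
X7/X8: x10b /
additive-p3 / bsd-ssimc) are untouched — these are SERVICE records on their cells, nothing of theirs superseded.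

WHAT. On referee A2's state `pub-bsdpct-r5-g15/scratchA2_state_after_kurx4am_add1c5_onA2R1030_fold.pkl`
(45ab5fdd2800f5ab) there
are 77 rank-ONE residue classes with an open cell `(3, X)`, `X ∈ {X11b, X4, X7, X8}`, whose curve `…1` has
`#Ш_an = 9`, `ρ̄_{E,3}`
onto (no Cremona galrep 3-code) and `3 ∤ #E(ℚ)_tors·∏c_ℓ` (population
`HOME/b2b-bsdres-x11c/gen38/squeeze/pop/pop38b.json`). On such
a cell neither a Kolyvagin `3 ∤ [E(K):ℤy_K]` certificate (GEN 35 KOLY3) nor a `dim Sel³ = rank` certificate (T-SEL3)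
can exist: BSD
predicts `Ш(E)[3^∞] ≅ (ℤ/3)²`. THE SQUEEZE (unit `b2b-bsdres-sha-2`'s
`Rank1Residual.bsdp_of_kolyvagin_index_of_casselsTate_of_pow_dvd`,
`X4/KolyvaginSqueeze.lean`; ANY odd `p`, analytic rank `≤ 1`, NO hypothesis on the reduction of `E` at `p`): UPPER
half
`ord₃ #Ш(E/ℚ) ≤ 2` from Kolyvagin as printed by McCallum 1991 §1 (`ord₃ #Ш(E/K) ≤ 2·ord₃ [E(K):ℤy_K]`, named facts
`kolyvagin`,
`Kolyvagin1990_padicValNat_card_sha_le`, registry A20, referee C2 ROUND 326 «p = 3 allowed as printed») with the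
odd-part splitting
`#Ш(E/K)[3^∞] = #Ш(E/ℚ)[3^∞]·#Ш(E^{(d_K)}/ℚ)[3^∞]` (JSW 2017 §7.4.1, tree theorem) and the certificate
`ord₃ [E(K):ℤy_K] ≤ 1`;
LOWER half `9 ∣ #Ш(E/ℚ)` from ONE descent line `#Sel^(3)(E/ℚ) = 27` (`rank = r_an = 1` by GZK, `3 ∤ #E(ℚ)_tors` by the
irreducibility of `E[3]` ⇒ `Ш(E)[3] ≠ 0`, `Typed.exists_sha_torsion_of_pow_rank_lt_card_selmerGroup`) and
Cassels–Tate squareness;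
with `#Ш_an = 9`: Miller's `BSD(E,3)`. KERNEL (per pair, through the unit's GEN 38 kit
`X11b.bsdp_three_of_kolyvaginIndexLeOne_of_card_selmer_of_irr_of_order`,
`X11b/KolyvaginSqueezeRecordsKitThree.lean`, every numeric
hypothesis a `decide` / `norm_num` goal): global minimality of Cremona's model by prover B's factored Kraus
criterion on the COMPLETE
factorisation of `|Δ|`; `ρ̄_{E,3}` ONTO from two Frobenius witnesses (Serre 1972 Prop. 15: an irreducible Frobenius
and one of order 3,
schema point counts). DISPLAYED binders per record (evidence, certified outside Lean — exactly the KOLY3 tuple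
referee A booked flag-free
at R958 / R961, plus `hCT`, the twist datum and `hSel`): `hGZK`, `hCT`, `hKo`, `hB`; the Heegner datum `K = ℚ(√D)`
(`hK`, `hH`),
`P = y_K` (`hP`, `hnt`) with `hI : ord₃ [E(K):ℤP] ≤ 1`; the twist datum `Wd` = Cremona's / PARI's minimal model of
`E^{(D)}` with
`hWd` (a `ℚ`-isomorphism class statement) and `hrD : r_an(Wd) ≤ 1` (the engines: root number `+1`, `L(E^D,1) ≠ 0`);
`hr : r_an = 1`,
`hq`/`hv : #Ш_an = 9` (Cremona); `hSel : #Sel^(3)(E/ℚ) = 3^3`.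
ENGINES (all BYTE-IDENTICAL, sha256 in each run folder's `outputs/inputs.sha256`; run folders
`HOME/b2b-bsdres-x11c/gen38/squeeze/harvest/<job>/`
with the daemon's `MANIFEST.json`): Heegner index — ENGINE 1 = the unit's gen-3 `main.py` (sha256 `69e29ec7…` = X9
g7 `jobD1b.py`;
PARI `ellL1`, `ellheight`, period lattice; `m² = 4·ĥ(y_K)/ĥ(x)` with `x` Cremona's generator saturated; kit j303974,
NDISC 12 /
DBOUND 6000: per pair the FIRST Heegner field `K = ℚ(√D)` (every `q ∣ N` split, `3 ∤ D`) with `ord₃ m = 1` is the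
certificate
field; earlier fields with `ord₃ m ≥ 2` are listed per row) ‖ ENGINE 2 = `run_cert.py` (sha256 `1b54bb20…`, stdlib
only, X9 gen 7:
recomputes `a_ℓ`, `L'(E,1)`, `L(E^D,1)`, the period lattice, `ĥ(x)` by Tate's series, `ĥ(y_K)` by
Gross–Zagier–Zhang, `m`,
`ord₃ m` — EQUAL —, plus a `3`-saturation witness prime for `x` and an `E(K)[3] = 0` witness prime; kit j304100) ‖
STAGE C =
additive-p1's `twistvals` (sha256 `e501b988…`; kit j304101): `N_{E^D}`, root number, `L(E^D,1)`, `Ω`, `#tors`, `∏c`,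
`#Ш_an(E^D)`
(BSD-consistency of the twist side: `3 ∤ #tors(E^D)·#Ш_an(E^D)`, as the squeeze predicts `Ш(E^D)[3] = 0`). Descent —
ENGINE C =
unit `b2b-bsdres-x11b`'s `desc3lib.gp` (sha256 `c4fb20b7…`, exact-element Schaefer–Stoll, one orbit = surjective
image; kit j305968) ‖
ENGINE E = unit `b2b-bsdres-x10b`'s INDEPENDENT `desc3full_e2.py` (sha256 `dfa51aff…`; kit j305969): per row the
descent grade EE / EL / LE / LL
(E = `EXACT(bnfcertify1+3sat)` equality, L = three independent EXACTLY verified Selmer elements = the unconditional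
lower bound `dim ≥ 3`,
equality modulo the class group); every row `dim Sel^(3)(E/ℚ) ≥ 3` on BOTH engines (expected `= rank + 2`),
Cremona's generator located in
the Selmer group; the kit consumes only `3³ ≤ #Sel^(3)(E/ℚ)` (`…_of_le_card_selmer_…`, the kit file's second
theorem). Tables:
`HOME/b2b-bsdres-x11c/gen38/squeeze/harvest/rows38b.json`, `gen38/squeeze/ROWS38B-TABLE.md`. THIS FILE (records 05):
7 pairs — `475536g1` (X11b), `480048e1` (X11b), `487713b1` (X11b), `493035e1` (X11b), `151299b1` (X4), `235944v1`
(X4), `295911u1` (X4).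

References: McCallum 1991 §1 [McCallumLMS1991]; Gross 1991 [GrossLMS1991]; Kolyvagin 1990
[KolyvaginEulerSystems1990]; Gross–Zagier
1986 [GrossZagier1986]; Jetchev–Skinner–Wan 2017 §7.4 [JetchevSkinnerWan2017]; Serre 1972 §2.4 Prop. 15 [Serre1972];
Silverman AEC
X.4.2, X.4.14, VII.3.1 [SilvermanAEC2009]; Kraus 1989 [Kraus1989]; Schaefer–Stoll 2004 [SchaeferStoll2004]; Miller
2011 Def. 1.1, Thm.
4.1 [Miller2011LMS]; Cremona's tables [Cremona2006].
-/

set_option autoImplicit false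

noncomputable section

open scoped Classical

open WeierstrassCurve Literature.NumberTheory.EllipticCurves
  Literature.NumberTheory.EllipticCurves.Rank1Residual
  Literature.NumberTheory.EllipticCurves.Rank1Residual.Typed
  Literature.NumberTheory.EllipticCurves.Rank1Residual.X11RankOneCertificates
  Summit.BirchSwinnertonDyer.BirchSwinnertonDyer.Rank1Residual.IntModel
  Summit.BirchSwinnertonDyer.BirchSwinnertonDyer.Rank1Residual.X11RankOne

namespace Summit.BirchSwinnertonDyer.Rank1Residual.X11b

/-- **`BSD(E,3)` for `475536g1`** (`N = 475536 = 2⁴·3·9907`; `3 ∥ N`, non-split multiplicative at `3`, `E[3]` irreducible (class X11b); `#tors = 1`,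
`∏c = 2` (`3 ∤ #tors·∏c`), `r_an = 1`, **`#Ш_an = 9`**, galrep none (no 3-code: `ρ̄_{E,3}` onto), generator `(4452, 295245)`; residue class of A2
state `45ab5fdd`, (3,'X11b') the SOLE open cell). HEEGNER INDEX (upper half): fields with `ord₃ m ≥ 2` before the certificate field: none. `D = -47`
(47 prime; every prime of `N` split, `3 ∤ D`): **`m = 12`, `ord₃ m = 1`** (`ρ = ĥ(y_K)/ĥ(x) = 36.00…`; `L′(E,1) = 5.81486935…`,
`L(E^D,1) = 0.18558513…`, `ĥ(x) = 2.96870843…`) — engine 1 (j303974) = engine 2 (j304100; EQUAL `m = 12`, `ord₃ m = 1`, dev. ≤ 9.4e-15, checks true;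
`3`-saturation witness prime [7, 12], `E(K)[3] = 0` witness prime [5, 'inert', 20]); twist `E^D` (stage C j304101): minimal model
`[0, -1, 0, -498927685, 4683122873581]`, `N_{E^D} = 1050459024`, root number `+1`, `L(E^D,1) = 0.18558513… ≠ 0` ⇒ `r_an(E^D) = 0`; `#tors = 1`,
`∏c = 4`, `#Ш_an(E^D) = 1` — `3 ∤ #tors·#Ш_an(E^D)` (BSD-shape: the squeeze forces `Ш(E^D)[3] = 0`). DESCENT (lower half): engine C x11b `desc3lib`
(j305968): octic `A` disc `-436860138576931272076032`, `S = [2, 3, 9907]`, `Cl(A) = [6, [6]]`, `bnfcertify(A,1) = 1`, `11` generators 3-saturated,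
`dim H¹(ℚ,E[3];S) = 3`, **`dim Sel^(3)(E/ℚ) = 3`** (expected 3: MATCH), generator in `Sel`, mode `GRH(3sat)`, cert `certs/cert_475536g1.gp`
`546d119b3984cce9…`; engine E x10b `desc3full_e2` (j305969): `Cl = [6, [6]]`, `Cl_S = [1, []]`, `11` generators, `bnfcertify = -2`, `dim H¹ = 3`,
**`dim Sel^(3)(E/ℚ) = 3`**, mode `LOWERBOUND` — TWO independent implementations, descent grade **LL** (E = equality EXACT, L = three independent
EXACTLY verified Selmer elements = the unconditional LOWER bound `dim ≥ 3`; the kit uses only `3³ ≤ #Sel`) ⇒ `27 ≤ #Sel^(3)(E/ℚ)`, `Ш(E)[3] ≠ 0` —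
the lower half. Witnesses mod `3` `(ℓ,#Ẽ(𝔽_ℓ))` = `(5,2)` (`a = 4`: `X² − aX + ℓ` root-free over `𝔽₃`), `(7,12)` (`ℓ ≡ 1`, `a = -4 ≡ 2 (mod 3)`,
`9 ∤ #Ẽ`). `|Δ| = ∏` over `[(2, 12), (3, 20), (9907, 1)]`. Kernel: minimality, onto, `3 ∣ #Ш` from `hSel`; displayed: `hGZK hCT hKo hB`, Heegner
datum (`hK hH hP hnt hI`), twist datum (`Wd hWd hrD`), `hr hq hv`, `hSel : 3³ ≤ #Sel^(3)(E/ℚ)`.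
[cite: McCallumLMS1991, §1 Theorem (Kolyvagin), p. 296] [cite: SilvermanAEC2009, Thm. X.4.2(a) and Thm. X.4.14] [cite: Serre1972, §2.4 Prop. 15] [cite: Cremona2006, Table 1 (label 475536g1)] -/
theorem bsdp_q475536g1_3 (hGZK : rank_eq_analyticRank_of_analyticRank_le_one)
    (hCT : exists_casselsTate_pairing (K := ℚ)) (W : WeierstrassCurve ℚ)
    (hW : W = ⟨0, -1, 0, -225861, -45029907⟩) {N : ℕ} [NeZero N] {K : Type} [Field K] [NumberField K]
    (hKo : kolyvagin N W K) (hB : Kolyvagin1990_padicValNat_card_sha_le N W K) (hK : IsImaginaryQuadratic K)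
    (hH : SatisfiesHeegnerHypothesis N K) {P : (W.baseChange K).toAffine.Point} (hP : IsHeegnerPoint N W K P)
    (hnt : ¬ IsOfFinAddOrder P) (hI : padicValNat 3 (AddSubgroup.zmultiples P).index ≤ 1)
    (Wd : WeierstrassCurve ℚ) [Wd.IsElliptic]
    (hWd : ∃ C : VariableChange ℚ, C • W.quadraticTwist ((NumberField.discr K : ℤ) : ℚ) = Wd)
    (hrD : Wd.analyticRank ≤ 1) (hr : W.analyticRank = 1)
    {q : ℚ} (hq : shaAn W = (q : ℂ)) (hv : padicValRat 3 q = 2)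
    (hSel : 3 ^ 3 ≤ Nat.card (W.selmerGroup (3 : ℤ))) : BSDp W 3 :=
  bsdp_three_of_kolyvaginIndexLeOne_of_le_card_selmer_of_irr_of_order 0 (-1) 0 (-225861) (-45029907)
    (Supersingular.isGloballyMinimal_of_krausCriterion₃_factored 0 (-1) 0 (-225861) (-45029907) [(2, 12), (3, 20), (9907, 1)] (by decide +kernel)
      (by intro t ht; fin_cases ht <;> norm_num) (by decide +kernel))
    5 7 (by norm_num) (by norm_num) (by decide) (by decide) (by decide) (by decide) (by decide +kernel) (by decide +kernel)
    (n₁ := 2) (n₂ := 12) (by decide +kernel) (by decide +kernel) (by decide) (by decide) (by decide) (by decide)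
    hGZK hCT W hW hKo hB hK hH hP hnt hI Wd hWd hrD hr hq hv hSel

/-- **`BSD(E,3)` for `480048e1`** (`N = 480048 = 2⁴·3·73·137`; `3 ∥ N`, non-split multiplicative at `3`, `E[3]` irreducible (class X11b); `#tors = 1`,
`∏c = 2` (`3 ∤ #tors·∏c`), `r_an = 1`, **`#Ш_an = 9`**, galrep none (no 3-code: `ρ̄_{E,3}` onto), generator `(732, 18769)`; residue class of A2
state `45ab5fdd`, (3,'X11b') the SOLE open cell). HEEGNER INDEX (upper half): fields with `ord₃ m ≥ 2` before the certificate field: none.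
`D = -119` (119 = 7·17; every prime of `N` split, `3 ∤ D`): **`m = 12`, `ord₃ m = 1`** (`ρ = ĥ(y_K)/ĥ(x) = 35.99…`; `L′(E,1) = 5.31580131…`,
`L(E^D,1) = 0.19892075…`, `ĥ(x) = 1.83569930…`) — engine 1 (j303974) = engine 2 (j304100; EQUAL `m = 12`, `ord₃ m = 1`, dev. ≤ 1.2e-14, checks true;
`3`-saturation witness prime [11, 12], `E(K)[3] = 0` witness prime [5, 'split', 7]); twist `E^D` (stage C j304101): minimal model
`[0, -1, 0, -682295861, 7009732922109]`, `N_{E^D} = 6797959728`, root number `+1`, `L(E^D,1) = 0.19892075… ≠ 0` ⇒ `r_an(E^D) = 0`; `#tors = 1`,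
`∏c = 4`, `#Ш_an(E^D) = 1` — `3 ∤ #tors·#Ш_an(E^D)` (BSD-shape: the squeeze forces `Ш(E^D)[3] = 0`). DESCENT (lower half): engine C x11b `desc3lib`
(j305968): octic `A` disc `-453677745739593230629632`, `S = [2, 3, 73, 137]`, `Cl(A) = [6, [6]]`, `bnfcertify(A,1) = 1`, `16` generators
3-saturated, `dim H¹(ℚ,E[3];S) = 4`, **`dim Sel^(3)(E/ℚ) = 3`** (expected 3: MATCH), generator in `Sel`, mode `GRH(3sat)`, cert
`certs/cert_480048e1.gp` `f2ae8c3508ae7152…`; engine E x10b `desc3full_e2` (j305969): `Cl = [6, [6]]`, `Cl_S = [1, []]`, `16` generators,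
`bnfcertify = -2`, `dim H¹ = 4`, **`dim Sel^(3)(E/ℚ) = 3`**, mode `LOWERBOUND` — TWO independent implementations, descent grade **LL** (E = equality
EXACT, L = three independent EXACTLY verified Selmer elements = the unconditional LOWER bound `dim ≥ 3`; the kit uses only `3³ ≤ #Sel`) ⇒
`27 ≤ #Sel^(3)(E/ℚ)`, `Ш(E)[3] ≠ 0` — the lower half. Witnesses mod `3` `(ℓ,#Ẽ(𝔽_ℓ))` = `(5,7)` (`a = -1`: `X² − aX + ℓ` root-free over `𝔽₃`),
`(31,42)` (`ℓ ≡ 1`, `a = -10 ≡ 2 (mod 3)`, `9 ∤ #Ẽ`). `|Δ| = ∏` over `[(2, 12), (3, 1), (73, 1), (137, 4)]`. Kernel: minimality, onto, `3 ∣ #Ш` from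
`hSel`; displayed: `hGZK hCT hKo hB`, Heegner datum (`hK hH hP hnt hI`), twist datum (`Wd hWd hrD`), `hr hq hv`, `hSel : 3³ ≤ #Sel^(3)(E/ℚ)`.
[cite: McCallumLMS1991, §1 Theorem (Kolyvagin), p. 296] [cite: SilvermanAEC2009, Thm. X.4.2(a) and Thm. X.4.14] [cite: Serre1972, §2.4 Prop. 15] [cite: Cremona2006, Table 1 (label 480048e1)] -/
theorem bsdp_q480048e1_3 (hGZK : rank_eq_analyticRank_of_analyticRank_le_one)
    (hCT : exists_casselsTate_pairing (K := ℚ)) (W : WeierstrassCurve ℚ)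
    (hW : W = ⟨0, -1, 0, -48181, -4143491⟩) {N : ℕ} [NeZero N] {K : Type} [Field K] [NumberField K]
    (hKo : kolyvagin N W K) (hB : Kolyvagin1990_padicValNat_card_sha_le N W K) (hK : IsImaginaryQuadratic K)
    (hH : SatisfiesHeegnerHypothesis N K) {P : (W.baseChange K).toAffine.Point} (hP : IsHeegnerPoint N W K P)
    (hnt : ¬ IsOfFinAddOrder P) (hI : padicValNat 3 (AddSubgroup.zmultiples P).index ≤ 1)
    (Wd : WeierstrassCurve ℚ) [Wd.IsElliptic]
    (hWd : ∃ C : VariableChange ℚ, C • W.quadraticTwist ((NumberField.discr K : ℤ) : ℚ) = Wd)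
    (hrD : Wd.analyticRank ≤ 1) (hr : W.analyticRank = 1)
    {q : ℚ} (hq : shaAn W = (q : ℂ)) (hv : padicValRat 3 q = 2)
    (hSel : 3 ^ 3 ≤ Nat.card (W.selmerGroup (3 : ℤ))) : BSDp W 3 :=
  bsdp_three_of_kolyvaginIndexLeOne_of_le_card_selmer_of_irr_of_order 0 (-1) 0 (-48181) (-4143491)
    (Supersingular.isGloballyMinimal_of_krausCriterion₃_factored 0 (-1) 0 (-48181) (-4143491) [(2, 12), (3, 1), (73, 1), (137, 4)] (by decide +kernel)
      (by intro t ht; fin_cases ht <;> norm_num) (by decide +kernel))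
    5 31 (by norm_num) (by norm_num) (by decide) (by decide) (by decide) (by decide) (by decide +kernel) (by decide +kernel)
    (n₁ := 7) (n₂ := 42) (by decide +kernel) (by decide +kernel) (by decide) (by decide) (by decide) (by decide)
    hGZK hCT W hW hKo hB hK hH hP hnt hI Wd hWd hrD hr hq hv hSel

/-- **`BSD(E,3)` for `487713b1`** (`N = 487713 = 3·17·73·131`; `3 ∥ N`, non-split multiplicative at `3`, `E[3]` irreducible (class X11b); `#tors = 1`,
`∏c = 2` (`3 ∤ #tors·∏c`), `r_an = 1`, **`#Ш_an = 9`**, galrep none (no 3-code: `ρ̄_{E,3}` onto), generator `(4090, 248518)`; residue class of A2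
state `45ab5fdd`, (3,'X11b') the SOLE open cell). HEEGNER INDEX (upper half): fields with `ord₃ m ≥ 2` before the certificate field: none. `D = -8`
(8 = 2³; every prime of `N` split, `3 ∤ D`): **`m = 12`, `ord₃ m = 1`** (`ρ = ĥ(y_K)/ĥ(x) = 36.00…`; `L′(E,1) = 3.59268497…`,
`L(E^D,1) = 0.45658207…`, `ĥ(x) = 2.79658479…`) — engine 1 (j303974) = engine 2 (j304100; EQUAL `m = 12`, `ord₃ m = 1`, dev. ≤ 3.6e-15, checks true;
`3`-saturation witness prime [11, 12], `E(K)[3] = 0` witness prime [23, 'inert', 512]); twist `E^D` (stage C j304101): minimal model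
`[0, -1, 0, -80078049, 276002426241]`, `N_{E^D} = 31213632`, root number `+1`, `L(E^D,1) = 0.45658207… ≠ 0` ⇒ `r_an(E^D) = 0`; `#tors = 1`,
`∏c = 4`, `#Ш_an(E^D) = 1` — `3 ∤ #tors·#Ш_an(E^D)` (BSD-shape: the squeeze forces `Ш(E^D)[3] = 0`). DESCENT (lower half): engine C x11b `desc3lib`
(j305968): octic `A` disc `-123738859990153763361604107`, `S = [3, 17, 73, 131]`, `Cl(A) = [6, [6]]`, `bnfcertify(A,1) = 1`, `14` generators
3-saturated, `dim H¹(ℚ,E[3];S) = 3`, **`dim Sel^(3)(E/ℚ) = 3`** (expected 3: MATCH), generator in `Sel`, mode `GRH(3sat)`, cert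
`certs/cert_487713b1.gp` `e91e5126a6c86a8b…`; engine E x10b `desc3full_e2` (j305969): `Cl = [6, [6]]`, `Cl_S = [1, []]`, `14` generators,
`bnfcertify = -2`, `dim H¹ = 3`, **`dim Sel^(3)(E/ℚ) = 3`**, mode `LOWERBOUND` — TWO independent implementations, descent grade **LL** (E = equality
EXACT, L = three independent EXACTLY verified Selmer elements = the unconditional LOWER bound `dim ≥ 3`; the kit uses only `3³ ≤ #Sel`) ⇒
`27 ≤ #Sel^(3)(E/ℚ)`, `Ш(E)[3] ≠ 0` — the lower half. Witnesses mod `3` `(ℓ,#Ẽ(𝔽_ℓ))` = `(23,32)` (`a = -8`: `X² − aX + ℓ` root-free over `𝔽₃`),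
`(139,132)` (`ℓ ≡ 1`, `a = 8 ≡ 2 (mod 3)`, `9 ∤ #Ẽ`). `|Δ| = ∏` over `[(3, 7), (17, 8), (73, 1), (131, 1)]`. Kernel: minimality, onto, `3 ∣ #Ш` from
`hSel`; displayed: `hGZK hCT hKo hB`, Heegner datum (`hK hH hP hnt hI`), twist datum (`Wd hWd hrD`), `hr hq hv`, `hSel : 3³ ≤ #Sel^(3)(E/ℚ)`.
[cite: McCallumLMS1991, §1 Theorem (Kolyvagin), p. 296] [cite: SilvermanAEC2009, Thm. X.4.2(a) and Thm. X.4.14] [cite: Serre1972, §2.4 Prop. 15] [cite: Cremona2006, Table 1 (label 487713b1)] -/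
theorem bsdp_q487713b1_3 (hGZK : rank_eq_analyticRank_of_analyticRank_le_one)
    (hCT : exists_casselsTate_pairing (K := ℚ)) (W : WeierstrassCurve ℚ)
    (hW : W = ⟨1, 1, 0, -1251219, -539536446⟩) {N : ℕ} [NeZero N] {K : Type} [Field K] [NumberField K]
    (hKo : kolyvagin N W K) (hB : Kolyvagin1990_padicValNat_card_sha_le N W K) (hK : IsImaginaryQuadratic K)
    (hH : SatisfiesHeegnerHypothesis N K) {P : (W.baseChange K).toAffine.Point} (hP : IsHeegnerPoint N W K P)
    (hnt : ¬ IsOfFinAddOrder P) (hI : padicValNat 3 (AddSubgroup.zmultiples P).index ≤ 1)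
    (Wd : WeierstrassCurve ℚ) [Wd.IsElliptic]
    (hWd : ∃ C : VariableChange ℚ, C • W.quadraticTwist ((NumberField.discr K : ℤ) : ℚ) = Wd)
    (hrD : Wd.analyticRank ≤ 1) (hr : W.analyticRank = 1)
    {q : ℚ} (hq : shaAn W = (q : ℂ)) (hv : padicValRat 3 q = 2)
    (hSel : 3 ^ 3 ≤ Nat.card (W.selmerGroup (3 : ℤ))) : BSDp W 3 :=
  bsdp_three_of_kolyvaginIndexLeOne_of_le_card_selmer_of_irr_of_order 1 1 0 (-1251219) (-539536446)
    (Supersingular.isGloballyMinimal_of_krausCriterion₃_factored 1 1 0 (-1251219) (-539536446) [(3, 7), (17, 8), (73, 1), (131, 1)] (by decide +kernel)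
      (by intro t ht; fin_cases ht <;> norm_num) (by decide +kernel))
    23 139 (by norm_num) (by norm_num) (by decide) (by decide) (by decide) (by decide) (by decide +kernel) (by decide +kernel)
    (n₁ := 32) (n₂ := 132) (by decide +kernel) (by decide +kernel) (by decide) (by decide) (by decide) (by decide)
    hGZK hCT W hW hKo hB hK hH hP hnt hI Wd hWd hrD hr hq hv hSel

/-- **`BSD(E,3)` for `493035e1`** (`N = 493035 = 3·5·32869`; `3 ∥ N`, non-split multiplicative at `3`, `E[3]` irreducible (class X11b); `#tors = 2`,
`∏c = 2` (`3 ∤ #tors·∏c`), `r_an = 1`, **`#Ш_an = 9`**, galrep 2B (no 3-code: `ρ̄_{E,3}` onto), generator `(134, 721)`; residue class of A2 state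
`45ab5fdd`, (3,'X11b') the SOLE open cell). HEEGNER INDEX (upper half): fields with `ord₃ m ≥ 2` before the certificate field: none. `D = -11` (11
prime; every prime of `N` split, `3 ∤ D`): **`m = 6`, `ord₃ m = 1`** (`ρ = ĥ(y_K)/ĥ(x) = 8.99…`; `L′(E,1) = 5.56198692…`, `L(E^D,1) = 0.66089927…`,
`ĥ(x) = 5.28395907…`) — engine 1 (j303974) = engine 2 (j304100; EQUAL `m = 6`, `ord₃ m = 1`, dev. ≤ 1.4e-14, checks true; `3`-saturation witness
prime [11, 12], `E(K)[3] = 0` witness prime [7, 'inert', 64]); twist `E^D` (stage C j304101): minimal model `[1, 1, 1, -1113021, 759857154]`,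
`N_{E^D} = 59657235`, root number `+1`, `L(E^D,1) = 0.66089927… ≠ 0` ⇒ `r_an(E^D) = 0`; `#tors = 2`, `∏c = 4`, `#Ш_an(E^D) = 4` —
`3 ∤ #tors·#Ш_an(E^D)` (BSD-shape: the squeeze forces `Ш(E^D)[3] = 0`). DESCENT (lower half): engine C x11b `desc3lib` (j305968): octic `A` disc
`-1595419022595816927016875`, `S = [3, 5, 7, 11, 32869]`, `Cl(A) = [3, [3]]`, `bnfcertify(A,1) = 1`, `18` generators 3-saturated,
`dim H¹(ℚ,E[3];S) = 4`, **`dim Sel^(3)(E/ℚ) = 3`** (expected 3: MATCH), generator in `Sel`, mode `GRH(3sat)`, cert `certs/cert_493035e1.gp`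
`26e5f3bbaaa6a426…`; engine E x10b `desc3full_e2` (j305969): `Cl = [3, [3]]`, `Cl_S = [1, []]`, `18` generators, `bnfcertify = -2`, `dim H¹ = 4`,
**`dim Sel^(3)(E/ℚ) = 3`**, mode `LOWERBOUND` — TWO independent implementations, descent grade **LL** (E = equality EXACT, L = three independent
EXACTLY verified Selmer elements = the unconditional LOWER bound `dim ≥ 3`; the kit uses only `3³ ≤ #Sel`) ⇒ `27 ≤ #Sel^(3)(E/ℚ)`, `Ш(E)[3] ≠ 0` —
the lower half. Witnesses mod `3` `(ℓ,#Ẽ(𝔽_ℓ))` = `(7,8)` (`a = 0`: `X² − aX + ℓ` root-free over `𝔽₃`), `(193,168)` (`ℓ ≡ 1`, `a = 26 ≡ 2 (mod 3)`,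
`9 ∤ #Ẽ`). `|Δ| = ∏` over `[(3, 3), (5, 5), (32869, 2)]`. Kernel: minimality, onto, `3 ∣ #Ш` from `hSel`; displayed: `hGZK hCT hKo hB`, Heegner
datum (`hK hH hP hnt hI`), twist datum (`Wd hWd hrD`), `hr hq hv`, `hSel : 3³ ≤ #Sel^(3)(E/ℚ)`.
[cite: McCallumLMS1991, §1 Theorem (Kolyvagin), p. 296] [cite: SilvermanAEC2009, Thm. X.4.2(a) and Thm. X.4.14] [cite: Serre1972, §2.4 Prop. 15] [cite: Cremona2006, Table 1 (label 493035e1)] -/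
theorem bsdp_q493035e1_3 (hGZK : rank_eq_analyticRank_of_analyticRank_le_one)
    (hCT : exists_casselsTate_pairing (K := ℚ)) (W : WeierstrassCurve ℚ)
    (hW : W = ⟨1, 1, 0, -9198, -575073⟩) {N : ℕ} [NeZero N] {K : Type} [Field K] [NumberField K]
    (hKo : kolyvagin N W K) (hB : Kolyvagin1990_padicValNat_card_sha_le N W K) (hK : IsImaginaryQuadratic K)
    (hH : SatisfiesHeegnerHypothesis N K) {P : (W.baseChange K).toAffine.Point} (hP : IsHeegnerPoint N W K P)
    (hnt : ¬ IsOfFinAddOrder P) (hI : padicValNat 3 (AddSubgroup.zmultiples P).index ≤ 1)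
    (Wd : WeierstrassCurve ℚ) [Wd.IsElliptic]
    (hWd : ∃ C : VariableChange ℚ, C • W.quadraticTwist ((NumberField.discr K : ℤ) : ℚ) = Wd)
    (hrD : Wd.analyticRank ≤ 1) (hr : W.analyticRank = 1)
    {q : ℚ} (hq : shaAn W = (q : ℂ)) (hv : padicValRat 3 q = 2)
    (hSel : 3 ^ 3 ≤ Nat.card (W.selmerGroup (3 : ℤ))) : BSDp W 3 :=
  bsdp_three_of_kolyvaginIndexLeOne_of_le_card_selmer_of_irr_of_order 1 1 0 (-9198) (-575073)
    (Supersingular.isGloballyMinimal_of_krausCriterion₃_factored 1 1 0 (-9198) (-575073) [(3, 3), (5, 5), (32869, 2)] (by decide +kernel)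
      (by intro t ht; fin_cases ht <;> norm_num) (by decide +kernel))
    7 193 (by norm_num) (by norm_num) (by decide) (by decide) (by decide) (by decide) (by decide +kernel) (by decide +kernel)
    (n₁ := 8) (n₂ := 168) (by decide +kernel) (by decide +kernel) (by decide) (by decide) (by decide) (by decide)
    hGZK hCT W hW hKo hB hK hH hP hnt hI Wd hWd hrD hr hq hv hSel

/-- **`BSD(E,3)` for `151299b1`** (`N = 151299 = 3²·16811`; additive at `3` (`v₃(N) = 2`), `E[3]` irreducible (class X4); `#tors = 2`, `∏c = 2`
(`3 ∤ #tors·∏c`), `r_an = 1`, **`#Ш_an = 9`**, galrep 2B (no 3-code: `ρ̄_{E,3}` onto), generator `(451/4, 89/8)`; residue class of A2 state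
`45ab5fdd`, (3,'X4') the SOLE open cell). HEEGNER INDEX (upper half): fields with `ord₃ m ≥ 2` before the certificate field: none. `D = -11` (11
prime; every prime of `N` split, `3 ∤ D`): **`m = 12`, `ord₃ m = 1`** (`ρ = ĥ(y_K)/ĥ(x) = 36.00…`; `L′(E,1) = 10.59938030…`,
`L(E^D,1) = 3.61641408…`, `ĥ(x) = 4.86631950…`) — engine 1 (j303974) = engine 2 (j304100; EQUAL `m = 12`, `ord₃ m = 1`, dev. ≤ 5.2e-15, checks true;
`3`-saturation witness prime [7, 6], `E(K)[3] = 0` witness prime [5, 'split', 2]); twist `E^D` (stage C j304101): minimal model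
`[1, -1, 1, -1145288, 472043674]`, `N_{E^D} = 18307179`, root number `+1`, `L(E^D,1) = 3.61641408… ≠ 0` ⇒ `r_an(E^D) = 0`; `#tors = 2`, `∏c = 8`,
`#Ш_an(E^D) = 4` — `3 ∤ #tors·#Ш_an(E^D)` (BSD-shape: the squeeze forces `Ш(E^D)[3] = 0`). DESCENT (lower half): engine C x11b `desc3lib` (j305968):
octic `A` disc `-174671872380887178267`, `S = [3, 16811]`, `Cl(A) = [3, [3]]`, `bnfcertify(A,1) = 1`, `8` generators 3-saturated,
`dim H¹(ℚ,E[3];S) = 3`, **`dim Sel^(3)(E/ℚ) = 3`** (expected 3: MATCH), generator in `Sel`, mode `GRH(3sat)`, cert `certs/cert_151299b1.gp`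
`2e2747f43b5b23cc…`; engine E x10b `desc3full_e2` (j305969): `Cl = [3, [3]]`, `Cl_S = [1, []]`, `8` generators, `bnfcertify = -2`, `dim H¹ = 3`,
**`dim Sel^(3)(E/ℚ) = 3`**, mode `LOWERBOUND` — TWO independent implementations, descent grade **LL** (E = equality EXACT, L = three independent
EXACTLY verified Selmer elements = the unconditional LOWER bound `dim ≥ 3`; the kit uses only `3³ ≤ #Sel`) ⇒ `27 ≤ #Sel^(3)(E/ℚ)`, `Ш(E)[3] ≠ 0` —
the lower half. Witnesses mod `3` `(ℓ,#Ẽ(𝔽_ℓ))` = `(5,2)` (`a = 4`: `X² − aX + ℓ` root-free over `𝔽₃`), `(7,6)` (`ℓ ≡ 1`, `a = 2 ≡ 2 (mod 3)`,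
`9 ∤ #Ẽ`). `|Δ| = ∏` over `[(3, 9), (16811, 1)]`. Kernel: minimality, onto, `3 ∣ #Ш` from `hSel`; displayed: `hGZK hCT hKo hB`, Heegner datum
(`hK hH hP hnt hI`), twist datum (`Wd hWd hrD`), `hr hq hv`, `hSel : 3³ ≤ #Sel^(3)(E/ℚ)`.
[cite: McCallumLMS1991, §1 Theorem (Kolyvagin), p. 296] [cite: SilvermanAEC2009, Thm. X.4.2(a) and Thm. X.4.14] [cite: Serre1972, §2.4 Prop. 15] [cite: Cremona2006, Table 1 (label 151299b1)] -/
theorem bsdp_q151299b1_3 (hGZK : rank_eq_analyticRank_of_analyticRank_le_one)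
    (hCT : exists_casselsTate_pairing (K := ℚ)) (W : WeierstrassCurve ℚ)
    (hW : W = ⟨1, -1, 0, -9465, -352072⟩) {N : ℕ} [NeZero N] {K : Type} [Field K] [NumberField K]
    (hKo : kolyvagin N W K) (hB : Kolyvagin1990_padicValNat_card_sha_le N W K) (hK : IsImaginaryQuadratic K)
    (hH : SatisfiesHeegnerHypothesis N K) {P : (W.baseChange K).toAffine.Point} (hP : IsHeegnerPoint N W K P)
    (hnt : ¬ IsOfFinAddOrder P) (hI : padicValNat 3 (AddSubgroup.zmultiples P).index ≤ 1)
    (Wd : WeierstrassCurve ℚ) [Wd.IsElliptic]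
    (hWd : ∃ C : VariableChange ℚ, C • W.quadraticTwist ((NumberField.discr K : ℤ) : ℚ) = Wd)
    (hrD : Wd.analyticRank ≤ 1) (hr : W.analyticRank = 1)
    {q : ℚ} (hq : shaAn W = (q : ℂ)) (hv : padicValRat 3 q = 2)
    (hSel : 3 ^ 3 ≤ Nat.card (W.selmerGroup (3 : ℤ))) : BSDp W 3 :=
  bsdp_three_of_kolyvaginIndexLeOne_of_le_card_selmer_of_irr_of_order 1 (-1) 0 (-9465) (-352072)
    (Supersingular.isGloballyMinimal_of_krausCriterion₃_factored 1 (-1) 0 (-9465) (-352072) [(3, 9), (16811, 1)] (by decide +kernel)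
      (by intro t ht; fin_cases ht <;> norm_num) (by decide +kernel))
    5 7 (by norm_num) (by norm_num) (by decide) (by decide) (by decide) (by decide) (by decide +kernel) (by decide +kernel)
    (n₁ := 2) (n₂ := 6) (by decide +kernel) (by decide +kernel) (by decide) (by decide) (by decide) (by decide)
    hGZK hCT W hW hKo hB hK hH hP hnt hI Wd hWd hrD hr hq hv hSel

/-- **`BSD(E,3)` for `235944v1`** (`N = 235944 = 2³·3²·29·113`; additive at `3` (`v₃(N) = 2`), `E[3]` irreducible (class X4); `#tors = 1`, `∏c = 20`
(`3 ∤ #tors·∏c`), `r_an = 1`, **`#Ш_an = 9`**, galrep none (no 3-code: `ρ̄_{E,3}` onto), generator `(-27, 339)`; residue class of A2 state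
`45ab5fdd`, (3,'X4') the SOLE open cell). HEEGNER INDEX (upper half): fields with `ord₃ m ≥ 2` before the certificate field: none. `D = -239` (239
prime; every prime of `N` split, `3 ∤ D`): **`m = 240`, `ord₃ m = 1`** (`ρ = ĥ(y_K)/ĥ(x) = 14400.00…`; `L′(E,1) = 12.11369342…`,
`L(E^D,1) = 3.13860603…`, `ĥ(x) = 0.18285389…`) — engine 1 (j303974) = engine 2 (j304100; EQUAL `m = 240`, `ord₃ m = 1`, dev. ≤ 1.1e-14, checks
true; `3`-saturation witness prime [5, 3], `E(K)[3] = 0` witness prime [11, 'split', 7]); twist `E^D` (stage C j304101): minimal model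
`[0, 0, 0, 727093209, -6529535382753]`, `N_{E^D} = 13477357224`, root number `+1`, `L(E^D,1) = 3.13860603… ≠ 0` ⇒ `r_an(E^D) = 0`; `#tors = 1`,
`∏c = 40`, `#Ш_an(E^D) = 4` — `3 ∤ #tors·#Ш_an(E^D)` (BSD-shape: the squeeze forces `Ш(E^D)[3] = 0`). DESCENT (lower half): engine C x11b `desc3lib`
(j305968): octic `A` disc `-258258429205513694208`, `S = [2, 3, 5, 29, 113]`, `Cl(A) = [3, [3]]`, `bnfcertify(A,1) = 1`, `17` generators
3-saturated, `dim H¹(ℚ,E[3];S) = 3`, **`dim Sel^(3)(E/ℚ) = 3`** (expected 3: MATCH), generator in `Sel`, mode `GRH(3sat)`, cert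
`certs/cert_235944v1.gp` `04a8f4745e589983…`; engine E x10b `desc3full_e2` (j305969): `Cl = [3, [3]]`, `Cl_S = [1, []]`, `17` generators,
`bnfcertify = -2`, `dim H¹ = 3`, **`dim Sel^(3)(E/ℚ) = 3`**, mode `LOWERBOUND` — TWO independent implementations, descent grade **LL** (E = equality
EXACT, L = three independent EXACTLY verified Selmer elements = the unconditional LOWER bound `dim ≥ 3`; the kit uses only `3³ ≤ #Sel`) ⇒
`27 ≤ #Sel^(3)(E/ℚ)`, `Ш(E)[3] ≠ 0` — the lower half. Witnesses mod `3` `(ℓ,#Ẽ(𝔽_ℓ))` = `(11,7)` (`a = 5`: `X² − aX + ℓ` root-free over `𝔽₃`),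
`(79,75)` (`ℓ ≡ 1`, `a = 5 ≡ 2 (mod 3)`, `9 ∤ #Ẽ`). `|Δ| = ∏` over `[(2, 4), (3, 3), (29, 1), (113, 5)]`. Kernel: minimality, onto, `3 ∣ #Ш` from
`hSel`; displayed: `hGZK hCT hKo hB`, Heegner datum (`hK hH hP hnt hI`), twist datum (`Wd hWd hrD`), `hr hq hv`, `hSel : 3³ ≤ #Sel^(3)(E/ℚ)`.
[cite: McCallumLMS1991, §1 Theorem (Kolyvagin), p. 296] [cite: SilvermanAEC2009, Thm. X.4.2(a) and Thm. X.4.14] [cite: Serre1972, §2.4 Prop. 15] [cite: Cremona2006, Table 1 (label 235944v1)] -/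
theorem bsdp_q235944v1_3 (hGZK : rank_eq_analyticRank_of_analyticRank_le_one)
    (hCT : exists_casselsTate_pairing (K := ℚ)) (W : WeierstrassCurve ℚ)
    (hW : W = ⟨0, 0, 0, 12729, 478287⟩) {N : ℕ} [NeZero N] {K : Type} [Field K] [NumberField K]
    (hKo : kolyvagin N W K) (hB : Kolyvagin1990_padicValNat_card_sha_le N W K) (hK : IsImaginaryQuadratic K)
    (hH : SatisfiesHeegnerHypothesis N K) {P : (W.baseChange K).toAffine.Point} (hP : IsHeegnerPoint N W K P)
    (hnt : ¬ IsOfFinAddOrder P) (hI : padicValNat 3 (AddSubgroup.zmultiples P).index ≤ 1)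
    (Wd : WeierstrassCurve ℚ) [Wd.IsElliptic]
    (hWd : ∃ C : VariableChange ℚ, C • W.quadraticTwist ((NumberField.discr K : ℤ) : ℚ) = Wd)
    (hrD : Wd.analyticRank ≤ 1) (hr : W.analyticRank = 1)
    {q : ℚ} (hq : shaAn W = (q : ℂ)) (hv : padicValRat 3 q = 2)
    (hSel : 3 ^ 3 ≤ Nat.card (W.selmerGroup (3 : ℤ))) : BSDp W 3 :=
  bsdp_three_of_kolyvaginIndexLeOne_of_le_card_selmer_of_irr_of_order 0 0 0 12729 478287
    (Supersingular.isGloballyMinimal_of_krausCriterion₃_factored 0 0 0 12729 478287 [(2, 4), (3, 3), (29, 1), (113, 5)] (by decide +kernel)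
      (by intro t ht; fin_cases ht <;> norm_num) (by decide +kernel))
    11 79 (by norm_num) (by norm_num) (by decide) (by decide) (by decide) (by decide) (by decide +kernel) (by decide +kernel)
    (n₁ := 7) (n₂ := 75) (by decide +kernel) (by decide +kernel) (by decide) (by decide) (by decide) (by decide)
    hGZK hCT W hW hKo hB hK hH hP hnt hI Wd hWd hrD hr hq hv hSel

/-- **`BSD(E,3)` for `295911u1`** (`N = 295911 = 3²·7²·11·61`; additive at `3` (`v₃(N) = 2`), `E[3]` irreducible (class X4); `#tors = 1`, `∏c = 2`
(`3 ∤ #tors·∏c`), `r_an = 1`, **`#Ш_an = 9`**, galrep none (no 3-code: `ρ̄_{E,3}` onto), generator `(-2036, 16)`; residue class of A2 state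
`45ab5fdd`, (3,'X4') the SOLE open cell). HEEGNER INDEX (upper half): fields with `ord₃ m ≥ 2` before the certificate field: none. `D = -83` (83
prime; every prime of `N` split, `3 ∤ D`): **`m = 24`, `ord₃ m = 1`** (`ρ = ĥ(y_K)/ĥ(x) = 143.99…`; `L′(E,1) = 5.94980988…`,
`L(E^D,1) = 0.24453975…`, `ĥ(x) = 4.11239960…`) — engine 1 (j303974) = engine 2 (j304100; EQUAL `m = 24`, `ord₃ m = 1`, dev. ≤ 3.0e-15, checks true;
`3`-saturation witness prime [17, 24], `E(K)[3] = 0` witness prime [5, 'inert', 32]); twist `E^D` (stage C j304101): minimal model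
`[0, 0, 1, -85745894976, 9664246267529005]`, `N_{E^D} = 2038530879`, root number `+1`, `L(E^D,1) = 0.24453975… ≠ 0` ⇒ `r_an(E^D) = 0`; `#tors = 1`,
`∏c = 8`, `#Ш_an(E^D) = 1` — `3 ∤ #tors·#Ш_an(E^D)` (BSD-shape: the squeeze forces `Ш(E^D)[3] = 0`). DESCENT (lower half): engine C x11b `desc3lib`
(j305968): octic `A` disc `-52158741466580921403`, `S = [3, 7, 11, 61]`, `Cl(A) = [6, [6]]`, `bnfcertify(A,1) = 1`, `15` generators 3-saturated,
`dim H¹(ℚ,E[3];S) = 3`, **`dim Sel^(3)(E/ℚ) = 3`** (expected 3: MATCH), generator in `Sel`, mode `GRH(3sat)`, cert `certs/cert_295911u1.gp`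
`7e90bdf745de2b49…`; engine E x10b `desc3full_e2` (j305969): `Cl = [6, [6]]`, `Cl_S = [1, []]`, `15` generators, `bnfcertify = -2`, `dim H¹ = 3`,
**`dim Sel^(3)(E/ℚ) = 3`**, mode `LOWERBOUND` — TWO independent implementations, descent grade **LL** (E = equality EXACT, L = three independent
EXACTLY verified Selmer elements = the unconditional LOWER bound `dim ≥ 3`; the kit uses only `3³ ≤ #Sel`) ⇒ `27 ≤ #Sel^(3)(E/ℚ)`, `Ш(E)[3] ≠ 0` —
the lower half. Witnesses mod `3` `(ℓ,#Ẽ(𝔽_ℓ))` = `(5,4)` (`a = 2`: `X² − aX + ℓ` root-free over `𝔽₃`), `(31,42)` (`ℓ ≡ 1`, `a = -10 ≡ 2 (mod 3)`,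
`9 ∤ #Ẽ`). `|Δ| = ∏` over `[(3, 3), (7, 10), (11, 5), (61, 1)]`. Kernel: minimality, onto, `3 ∣ #Ш` from `hSel`; displayed: `hGZK hCT hKo hB`,
Heegner datum (`hK hH hP hnt hI`), twist datum (`Wd hWd hrD`), `hr hq hv`, `hSel : 3³ ≤ #Sel^(3)(E/ℚ)`.
[cite: McCallumLMS1991, §1 Theorem (Kolyvagin), p. 296] [cite: SilvermanAEC2009, Thm. X.4.2(a) and Thm. X.4.14] [cite: Serre1972, §2.4 Prop. 15] [cite: Cremona2006, Table 1 (label 295911u1)] -/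
theorem bsdp_q295911u1_3 (hGZK : rank_eq_analyticRank_of_analyticRank_le_one)
    (hCT : exists_casselsTate_pairing (K := ℚ)) (W : WeierstrassCurve ℚ)
    (hW : W = ⟨0, 0, 1, -12446784, -16901829296⟩) {N : ℕ} [NeZero N] {K : Type} [Field K] [NumberField K]
    (hKo : kolyvagin N W K) (hB : Kolyvagin1990_padicValNat_card_sha_le N W K) (hK : IsImaginaryQuadratic K)
    (hH : SatisfiesHeegnerHypothesis N K) {P : (W.baseChange K).toAffine.Point} (hP : IsHeegnerPoint N W K P)
    (hnt : ¬ IsOfFinAddOrder P) (hI : padicValNat 3 (AddSubgroup.zmultiples P).index ≤ 1)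
    (Wd : WeierstrassCurve ℚ) [Wd.IsElliptic]
    (hWd : ∃ C : VariableChange ℚ, C • W.quadraticTwist ((NumberField.discr K : ℤ) : ℚ) = Wd)
    (hrD : Wd.analyticRank ≤ 1) (hr : W.analyticRank = 1)
    {q : ℚ} (hq : shaAn W = (q : ℂ)) (hv : padicValRat 3 q = 2)
    (hSel : 3 ^ 3 ≤ Nat.card (W.selmerGroup (3 : ℤ))) : BSDp W 3 :=
  bsdp_three_of_kolyvaginIndexLeOne_of_le_card_selmer_of_irr_of_order 0 0 1 (-12446784) (-16901829296)
    (Supersingular.isGloballyMinimal_of_krausCriterion₃_factored 0 0 1 (-12446784) (-16901829296) [(3, 3), (7, 10), (11, 5), (61, 1)] (by decide +kernel)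
      (by intro t ht; fin_cases ht <;> norm_num) (by decide +kernel))
    5 31 (by norm_num) (by norm_num) (by decide) (by decide) (by decide) (by decide) (by decide +kernel) (by decide +kernel)
    (n₁ := 4) (n₂ := 42) (by decide +kernel) (by decide +kernel) (by decide) (by decide) (by decide) (by decide)
    hGZK hCT W hW hKo hB hK hH hP hnt hI Wd hWd hrD hr hq hv hSel

end Summit.BirchSwinnertonDyer.Rank1Residual.X11b

end
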